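import Summits.ABC.ABC.Theorems.TwistAmplificationSomeWindowSavingInertBox
import Summits.ABC.ABC.Theorems.IsogenyGlueCongruencePolyHeightOfBoundedPrimesStubHallHalfAllIffWeakHall
import Literature.NumberTheory.EllipticCurves.ModularCurveManinSemistableCoprimeFormProofs
import Literature.NumberTheory.EllipticCurves.SzpiroOfAbcProofs
import HarnessLib

/-!
# Route TwistAmplification — crux `SomeWindowSaving` (stmt-ABC-1976): the typed SPLIT into its two
classical faces (crux-strategist decomposition, 2026-08-17)

The crux `Summit.ABC.ABC.Theses.TwistAmplification.SomeWindowSaving` (r3) is, by the landed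
calibration `someWindowSaving_iff_cofiniteWeakGenSzpiro` (TwistAmplificationSomeWindowSavingCalibration),
COFINITE WEAK GENERALIZED SZPIRO: `∃ K N₀, max(|Δ|,|c₄|³) ≤ N^K` for every minimal integral model
with `c₄c₆ ≠ 0` and conductor `N ≥ N₀`.  Four line families (modular degree, twist/Hall, period/BSD,
base change; 5 leads, 2 ideation rounds) reduced it to weak generalized Szpiro with no slack.  This file
records the decomposition the strategist files on the route (`ledger route edit --split
SomeWindowSaving --into WeakSzpiroDelta WeakHall --glue-by SomeWindowSaving_of_subs`):

* `WeakSzpiroDelta` — Oesterlé's WEAK SZPIRO CONJECTURE (Sém. Bourbaki 694 (1988) §2 Conj. 1 with a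
  free exponent; vocabulary of `Literature.NumberTheory.EllipticCurves.SzpiroConjecture`):
  `∃ K C, ∀ E/ℚ elliptic, N(𝔇_min(E)) ≤ C · N_E^K` — the Δ-FACE (arithmetic / modular engines);
* `WeakHall` — HALL'S CONJECTURE WITH A FREE EXPONENT (`∃ θ > 0, C > 0, HallBound θ C`, i.e.
  `C·x^θ ≤ |x³ − y²|` on positive naturals; Elkies 2000 §4.1: open for every `θ > 0`;
  `Literature.Barriers.ABC.HallExponentSharp`) — the c₄-FACE (Diophantine approximation engines).

Contents (all sorry-free, fact-free):
* `SomeWindowSaving_of_subs : WeakSzpiroDelta → WeakHall → SomeWindowSaving` — the split glue, which is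
  the landed `someWindowSaving_of_weakSzpiro_of_weakHall` (factorisation `N ↦ Δ ↦ c₄`,
  `c₄³ − c₆² = 1728Δ`).
* `weakSzpiroDelta_of_weakGenSzpiro`, `hallHalfAll_of_weakGenSzpiro`, `weakHall_of_weakGenSzpiro`,
  `subs_of_weakGenSzpiro` — EXACTNESS of the split: weak generalized Szpiro
  (`∃ K C, max(|Δ|,|c₄|³) ≤ C·N^K` on all minimal integral models, the hypothesis of
  `someWindowSaving_of_weakGenSzpiro`) implies BOTH children (for the Hall face through `N_E ∣ N(𝔇_min)`
  and the landed `PolyHeightOfBoundedPrimes.HallSplit.weakHall_of_hallHalfAll`, i.e. the curve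
  `Y² = X³ − 27x·X − 54y`).  Together with the calibration (crux ↔ cofinite WGS) and Shafarevich's
  theorem (proved in the tree, `WeierstrassCurve.shafarevich_finite_goodReductionOutside_holds`, which
  upgrades cofinite WGS to WGS with a constant — not formalised here) this shows the split is LOSSLESS:
  neither child is the crux reworded (each drops one face), and their conjunction is the crux.

Lands `--supports stmt-ABC-1976`.  References: [Oesterle1988] §2 Conj. 1; [BombieriGubler2006] §12.5;
[SilvermanAEC2009] VIII.8, VIII.11; N. Elkies, *Rational points near curves …*, ANTS-IV (2000) §4.1.
-/

noncomputable section

-- single-conjunct summit ABC: the duplicate ABC.ABC is mandated (CONVENTIONS §2)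
set_option linter.dupNamespace false

namespace Summit.ABC.ABC.Theorems

open IsDedekindDomain WeierstrassCurve
open Summit.ABC.ABC.Theses.TwistAmplification (SomeWindowSaving)
open Literature.Barriers.ABC (HallBound)
open Literature.NumberTheory.DiophantineGeometry (hallBound_int_of_hallBound)
open Literature.NumberTheory.EllipticCurves

/-! ## The split glue -/

/-- **SPLIT GLUE `WeakSzpiroDelta → WeakHall → SomeWindowSaving`** (the `--glue-by` theorem of the
strategist's decomposition of stmt-ABC-1976).  Weak Szpiro (`∃ K C, N(𝔇_min(E)) ≤ C·N_E^K` for every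
elliptic `E/ℚ`) and weak Hall (`∃ θ > 0, C > 0, HallBound θ C`) give weak generalized Szpiro by the
factorisation `N ↦ Δ ↦ c₄` (`c₄³ − c₆² = 1728Δ`), hence the crux through the inert box — verbatim the
landed `someWindowSaving_of_weakSzpiro_of_weakHall`. [folklore] -/
theorem SomeWindowSaving_of_subs
    (hΔ : ∃ K C : ℝ, ∀ (W : WeierstrassCurve ℚ) [W.IsElliptic],
      (W.minimalDiscriminantNorm ℤ : ℝ) ≤ C * (W.conductorNorm ℤ : ℝ) ^ K)
    (hH : ∃ θ C : ℝ, 0 < θ ∧ 0 < C ∧ HallBound θ C) : SomeWindowSaving :=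
  someWindowSaving_of_weakSzpiro_of_weakHall hΔ hH

/-! ## Exactness: weak generalized Szpiro gives both children -/

/-- **WGS ⟹ the Δ-face.**  Weak generalized Szpiro on all minimal integral models
(`max(|Δ|,|c₄|³) ≤ C·N^K`) gives weak Szpiro `N(𝔇_min(E)) ≤ C·N_E^K` for every elliptic `E/ℚ`:
pass to a global minimal integral equation `W₀` of `E` (`exists_baseChange_int_forall_isMinimalAt`,
Silverman AEC VIII.8.3), where `N(𝔇_min) = |Δ(W₀)| ≤ max(|Δ|,|c₄|³)` (`minimalDiscriminantNorm_eq_natAbs`)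
and `N_E`, `N(𝔇_min)` are isomorphism invariants (`conductorNorm_smul_rat`,
`minimalDiscriminantNorm_smul_rat`). [cite: SilvermanAEC2009, VIII.8] -/
theorem weakSzpiroDelta_of_weakGenSzpiro
    (h : ∃ K C : ℝ, ∀ W₀ : WeierstrassCurve ℤ, (W₀.baseChange ℚ).IsElliptic →
      (∀ v : HeightOneSpectrum ℤ, (W₀.baseChange ℚ).IsMinimalAt v) →
        ((max |W₀.Δ| (|W₀.c₄| ^ 3) : ℤ) : ℝ) ≤ C * (((W₀.baseChange ℚ).conductorNorm ℤ : ℕ) : ℝ) ^ K) :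
    ∃ K C : ℝ, ∀ (W : WeierstrassCurve ℚ) [W.IsElliptic],
      (W.minimalDiscriminantNorm ℤ : ℝ) ≤ C * (W.conductorNorm ℤ : ℝ) ^ K := by
  obtain ⟨K, C, h⟩ := h
  refine ⟨K, C, fun W _ ↦ ?_⟩
  obtain ⟨D, W₀, hDW, hmin⟩ := exists_baseChange_int_forall_isMinimalAt W
  have hΔ0 : W₀.Δ ≠ 0 := by
    intro h0
    have h1 : (D • W).Δ = 0 := by rw [hDW, baseChange_int_Δ, h0, Int.cast_zero]
    exact (D • W).isUnit_Δ.ne_zero h1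
  haveI hE : (W₀.baseChange ℚ).IsElliptic := isElliptic_baseChange_int W₀ hΔ0
  have hmain := h W₀ hE hmin
  have hN : W.conductorNorm ℤ = (W₀.baseChange ℚ).conductorNorm ℤ := by
    rw [← conductorNorm_smul_rat W D, hDW]
  have hD : W.minimalDiscriminantNorm ℤ = W₀.Δ.natAbs := by
    rw [← minimalDiscriminantNorm_smul_rat W D, hDW,
      minimalDiscriminantNorm_eq_natAbs_holds W₀ hΔ0 hmin]
  rw [hD, hN, Nat.cast_natAbs, Int.cast_abs]
  calc |(W₀.Δ : ℝ)| ≤ ((max |W₀.Δ| (|W₀.c₄| ^ 3) : ℤ) : ℝ) := by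
        push_cast
        exact le_max_left _ _
    _ ≤ C * (((W₀.baseChange ℚ).conductorNorm ℤ : ℕ) : ℝ) ^ K := hmain

/-- **WGS ⟹ the Hall half on all global minimal models** (`|c₄(W)|³ ≤ C·|Δ_W|^σ`).  On the integral
model `W_ℤ` of a global minimal `W/ℚ` (`integralModelInt`, `baseChange_integralModelInt`; minimal at
every prime by `IsGloballyMinimal.isMinimalAt_int`): `|c₄|³ ≤ max(|Δ|,|c₄|³) ≤ C·N^K ≤ C·|Δ|^K`,
because `N_E ∣ N(𝔇_min) = |Δ(W_ℤ)|` (`conductorNorm_dvd_minimalDiscriminantNorm`, Silverman ATAEC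
IV.11.1, and `minimalDiscriminantNorm_eq_natAbs`).  [cite: SilvermanAEC2009, VIII.8 and VIII.11] -/
theorem hallHalfAll_of_weakGenSzpiro
    (h : ∃ K C : ℝ, ∀ W₀ : WeierstrassCurve ℤ, (W₀.baseChange ℚ).IsElliptic →
      (∀ v : HeightOneSpectrum ℤ, (W₀.baseChange ℚ).IsMinimalAt v) →
        ((max |W₀.Δ| (|W₀.c₄| ^ 3) : ℤ) : ℝ) ≤ C * (((W₀.baseChange ℚ).conductorNorm ℤ : ℕ) : ℝ) ^ K) :
    ∃ σ C : ℝ, 0 ≤ σ ∧ ∀ (W : WeierstrassCurve ℚ) [W.IsElliptic] [W.IsGloballyMinimal],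
      ((|W.c₄| ^ 3 : ℚ) : ℝ) ≤ C * ((|W.Δ| : ℚ) : ℝ) ^ σ := by
  obtain ⟨K, C, h⟩ := h
  refine ⟨max K 0, max C 0, le_max_right _ _, fun W _ _ ↦ ?_⟩
  have hb : (integralModelInt W).baseChange ℚ = W := baseChange_integralModelInt W
  haveI hE : ((integralModelInt W).baseChange ℚ).IsElliptic := by rw [hb]; infer_instance
  have hmin : ∀ v : HeightOneSpectrum ℤ, ((integralModelInt W).baseChange ℚ).IsMinimalAt v := by
    rw [hb]; exact IsGloballyMinimal.isMinimalAt_int W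
  have hmain := h (integralModelInt W) hE hmin
  have hΔ0 : (integralModelInt W).Δ ≠ 0 := by
    intro h0
    apply ((integralModelInt W).baseChange ℚ).isUnit_Δ.ne_zero
    rw [baseChange_int_Δ, h0, Int.cast_zero]
  -- `1 ≤ N ≤ |Δ(W_ℤ)|`
  have hN1 : (1 : ℝ) ≤ ((((integralModelInt W).baseChange ℚ).conductorNorm ℤ : ℕ) : ℝ) := by
    exact_mod_cast conductorNorm_pos_holds ((integralModelInt W).baseChange ℚ)
  have hNΔ : ((((integralModelInt W).baseChange ℚ).conductorNorm ℤ : ℕ) : ℝ) ≤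
      |((integralModelInt W).Δ : ℝ)| := by
    have hfin := WeierstrassCurve.finite_setOf_ordMinimalDiscriminant_ne_zero_holds (A := ℤ)
      ((integralModelInt W).baseChange ℚ)
    have hdvd := ((integralModelInt W).baseChange ℚ).conductorNorm_dvd_minimalDiscriminantNorm hfin
    have hpos := ((integralModelInt W).baseChange ℚ).minimalDiscriminantNorm_pos_holds
    have hle : ((integralModelInt W).baseChange ℚ).conductorNorm ℤ ≤
        ((integralModelInt W).baseChange ℚ).minimalDiscriminantNorm ℤ := Nat.le_of_dvd hpos hdvd
    rw [minimalDiscriminantNorm_eq_natAbs_holds (integralModelInt W) hΔ0 hmin] at hle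
    have hle' : ((((integralModelInt W).baseChange ℚ).conductorNorm ℤ : ℕ) : ℝ) ≤
        (((integralModelInt W).Δ.natAbs : ℕ) : ℝ) := by exact_mod_cast hle
    rwa [Nat.cast_natAbs, Int.cast_abs] at hle'
  -- the casts `ℚ → ℝ` on the left, read on `W_ℤ`
  have hc4q : W.c₄ = ((integralModelInt W).c₄ : ℚ) := (cast_integralModelInt_c₄ W).symm
  have hΔq : W.Δ = ((integralModelInt W).Δ : ℚ) := (cast_integralModelInt_Δ W).symm
  have hc4 : ((|W.c₄| ^ 3 : ℚ) : ℝ) = |((integralModelInt W).c₄ : ℝ)| ^ 3 := by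
    rw [hc4q]; push_cast; rfl
  have hΔ : ((|W.Δ| : ℚ) : ℝ) = |((integralModelInt W).Δ : ℝ)| := by
    rw [hΔq]; push_cast; rfl
  rw [hc4, hΔ]
  set N : ℝ := ((((integralModelInt W).baseChange ℚ).conductorNorm ℤ : ℕ) : ℝ) with hNdef
  have hN0 : (0 : ℝ) ≤ N := zero_le_one.trans hN1
  have hK : (0 : ℝ) ≤ max K 0 := le_max_right _ _
  have hC : (0 : ℝ) ≤ max C 0 := le_max_right _ _
  calc |((integralModelInt W).c₄ : ℝ)| ^ 3
        ≤ ((max |(integralModelInt W).Δ| (|(integralModelInt W).c₄| ^ 3) : ℤ) : ℝ) := by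
          push_cast
          exact le_max_right _ _
    _ ≤ C * N ^ K := hmain
    _ ≤ max C 0 * N ^ K := mul_le_mul_of_nonneg_right (le_max_left _ _) (Real.rpow_nonneg hN0 _)
    _ ≤ max C 0 * N ^ (max K 0) :=
          mul_le_mul_of_nonneg_left (Real.rpow_le_rpow_of_exponent_le hN1 (le_max_left _ _)) hC
    _ ≤ max C 0 * |((integralModelInt W).Δ : ℝ)| ^ (max K 0) :=
          mul_le_mul_of_nonneg_left (Real.rpow_le_rpow hN0 hNΔ hK) hC

/-- **WGS ⟹ the c₄-face (weak Hall).**  Compose `hallHalfAll_of_weakGenSzpiro` with the landed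
`PolyHeightOfBoundedPrimes.HallSplit.weakHall_of_hallHalfAll` (the curve `Y² = X³ − 27x·X − 54y`,
`c₄ = 6⁴x`, `Δ = 2⁶3⁹(x³ − y²)`, and a global minimal equation of it) and restrict the integer
statement to positive naturals (`HallBound`). [cite: BombieriGubler2006, 12.5] -/
theorem weakHall_of_weakGenSzpiro
    (h : ∃ K C : ℝ, ∀ W₀ : WeierstrassCurve ℤ, (W₀.baseChange ℚ).IsElliptic →
      (∀ v : HeightOneSpectrum ℤ, (W₀.baseChange ℚ).IsMinimalAt v) →
        ((max |W₀.Δ| (|W₀.c₄| ^ 3) : ℤ) : ℝ) ≤ C * (((W₀.baseChange ℚ).conductorNorm ℤ : ℕ) : ℝ) ^ K) :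
    ∃ θ C : ℝ, 0 < θ ∧ 0 < C ∧ HallBound θ C := by
  obtain ⟨θ, c, hθ, hc, hZ⟩ :=
    PolyHeightOfBoundedPrimes.HallSplit.weakHall_of_hallHalfAll (hallHalfAll_of_weakGenSzpiro h)
  refine ⟨θ, c, hθ, hc, fun x y hx _ hne ↦ ?_⟩
  have hneZ : (x : ℤ) ^ 3 ≠ (y : ℤ) ^ 2 := by exact_mod_cast hne
  have key := hZ x y hneZ
  have hxabs : |((x : ℤ) : ℝ)| = (x : ℝ) := by
    rw [Int.cast_natCast]
    exact abs_of_nonneg (Nat.cast_nonneg x)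
  rw [hxabs] at key
  have e1 : ((x : ℤ) : ℝ) = (x : ℝ) := Int.cast_natCast x
  have e2 : ((y : ℤ) : ℝ) = (y : ℝ) := Int.cast_natCast y
  rw [e1, e2] at key
  exact key

/-- **EXACTNESS OF THE SPLIT.**  Weak generalized Szpiro (all minimal integral models) implies both
children `WeakSzpiroDelta ∧ WeakHall`; conversely the children give the crux (`SomeWindowSaving_of_subs`)
and the crux is cofinite weak generalized Szpiro (`someWindowSaving_iff_cofiniteWeakGenSzpiro`, landed).
So modulo Shafarevich finiteness below the cofinite threshold (a tree theorem,
`WeierstrassCurve.shafarevich_finite_goodReductionOutside_holds`; the upgrade cofinite → uniform is not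
formalised here) the decomposition `SomeWindowSaving ⟸ WeakSzpiroDelta ∧ WeakHall` loses nothing, and
neither child alone is the crux: each omits one face. [folklore] -/
theorem subs_of_weakGenSzpiro
    (h : ∃ K C : ℝ, ∀ W₀ : WeierstrassCurve ℤ, (W₀.baseChange ℚ).IsElliptic →
      (∀ v : HeightOneSpectrum ℤ, (W₀.baseChange ℚ).IsMinimalAt v) →
        ((max |W₀.Δ| (|W₀.c₄| ^ 3) : ℤ) : ℝ) ≤ C * (((W₀.baseChange ℚ).conductorNorm ℤ : ℕ) : ℝ) ^ K) :
    (∃ K C : ℝ, ∀ (W : WeierstrassCurve ℚ) [W.IsElliptic],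
      (W.minimalDiscriminantNorm ℤ : ℝ) ≤ C * (W.conductorNorm ℤ : ℝ) ^ K) ∧
    (∃ θ C : ℝ, 0 < θ ∧ 0 < C ∧ HallBound θ C) :=
  ⟨weakSzpiroDelta_of_weakGenSzpiro h, weakHall_of_weakGenSzpiro h⟩

/-- The round trip on the hypothesis side: the two children reassemble weak generalized Szpiro's
consequence, the crux (sanity `example`; the content is `SomeWindowSaving_of_subs`). [folklore] -/
example
    (h : ∃ K C : ℝ, ∀ W₀ : WeierstrassCurve ℤ, (W₀.baseChange ℚ).IsElliptic →
      (∀ v : HeightOneSpectrum ℤ, (W₀.baseChange ℚ).IsMinimalAt v) →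
        ((max |W₀.Δ| (|W₀.c₄| ^ 3) : ℤ) : ℝ) ≤ C * (((W₀.baseChange ℚ).conductorNorm ℤ : ℕ) : ℝ) ^ K) :
    SomeWindowSaving :=
  SomeWindowSaving_of_subs (subs_of_weakGenSzpiro h).1 (subs_of_weakGenSzpiro h).2

end Summit.ABC.ABC.Theorems

end
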